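import Mathlib.MeasureTheory.Function.Jacobian
import Mathlib.MeasureTheory.Constructions.BorelSpace.Complex
import Mathlib.MeasureTheory.Measure.Haar.OfBasis
import Mathlib.MeasureTheory.Measure.WithDensity
import Mathlib.Analysis.Calculus.FDeriv.RestrictScalars
import Mathlib.Analysis.Calculus.Deriv.Mul
import Mathlib.Analysis.Calculus.Deriv.Inv
import Mathlib.Analysis.SpecialFunctions.Pow.Real
import Mathlib.LinearAlgebra.Complex.Determinant
import Mathlib.LinearAlgebra.Complex.FiniteDimensional
import Mathlib.RingTheory.Complex
import Mathlib.RingTheory.Norm.Transitivity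
import Mathlib.LinearAlgebra.Matrix.Determinant.Basic
import Literature.Analysis.Complex.LengthArea                 -- ★ `LengthArea.det_restrictScalars_smulRight` (the real Jacobian of `z ↦ cz` is `‖c‖²`)
import HarnessLib

/-!
# The hyperbolic measure `(1 − |w|²)⁻² dA` on the unit disc is invariant under the Möbius maps of `U(1,1)`
(Poincaré disc model; Helgason, *Groups and Geometric Analysis* (2000), Introduction §4; Rudin, *Function Theory in the Unit Ball* (1980), Thm. 2.2.6 — in Mathlib the
upper-half-plane twin is `UpperHalfPlane.instSMulInvariantMeasure`, whose proof this file ports to the disc)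

Topic `Analysis/Complex`; namespace `Literature.Analysis.Complex`.  Two definitions with bodies (`discMoebius`, `discHyperbolicMeasure`) and PROVED theorems;
no instance, no notation, no axiom, no named fact, no `sorry`.  Cell `pub/hodgecm-mathlib`, ENGINE T1 (crux H413 = `stmt-HodgeConjecture-24833`), floor-2 road
«(J-nc) in-house: DESCENT + HAT-BOX» (PLAN v8), brick (H1) of the HAT-BOX measure identity on `U(1,1)` (F0P3a-p07 (g7) census `CENSUS-ROAD-Sd-JUNCTION` d13cf214 §5;
consumers: (H2) `ArchRankOneOrbitChart` (the orbit chart `U(1,1) ⧸ T ≃ 𝔻` and uniqueness of invariant measures), B-p17 (g23)'s rank-one limit formula FILE K∕M,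
p06 (g10)'s descent (d1)(d2)).  Generic: any `h ∈ M₂(ℂ)` with `hᴴ · diag(1,−1) · h = diag(1,−1)`.

WHAT IS PROVED (`J = diag(1, −1)`, `h : Matrix (Fin 2) (Fin 2) ℂ` with `hU : hᴴ * J * h = J`; `M_h w = (h₁₀ + h₁₁ w) ∕ (h₀₀ + h₀₁ w)` — the action on the
line `[1 : w]`, i.e. on the ratio `v₁ ∕ v₀` of a `J`-positive vector `v`, so that `M_{gh} = M_g ∘ M_h` and the orbit map `h ↦ h₁₀ ∕ h₀₀` is equivariant):
* §1 algebra of `U(1,1)`: `normSq_apply_00_sub_normSq_apply_10` (`|h₀₀|² − |h₁₀|² = 1`), `normSq_apply_01_sub_normSq_apply_11` (`= −1`), `conj_apply_00_mul_apply_01_sub`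
  (`h̄₀₀h₀₁ = h̄₁₀h₁₁`), `norm_det_eq_one` (`|det h| = 1`), and THE KEY IDENTITY **`normSq_den_sub_normSq_num`**: `|h₀₀ + h₀₁w|² − |h₁₀ + h₁₁w|² = 1 − |w|²`
  (the form value of `h·(1,w)ᵀ`); hence `den_ne_zero_of_norm_lt_one`, **`norm_discMoebius_lt_one`** (`M_h` maps `𝔻` to `𝔻`), `one_sub_normSq_discMoebius`
  (`1 − |M_h w|² = (1 − |w|²) ∕ |h₀₀ + h₀₁w|²`), `injOn_discMoebius_ball`; `discMoebius_one`, **`discMoebius_mul`** (the composition law `M_{gh} = M_g ∘ M_h` wherever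
  `M_h` is defined), `measurable_discMoebius`.
* §2 calculus: **`hasDerivAt_discMoebius`** (`M_h′(w) = det h ∕ (h₀₀ + h₀₁w)²`, quotient rule); the real Jacobian of `z ↦ cz` is `‖c‖²` by ★ `LengthArea.det_restrictScalars_smulRight`
  (`Literature/Analysis/Complex/LengthArea`).
* §3 the measure: **`discHyperbolicMeasure = (1 − ‖w‖²)⁻² · dA|_𝔻`** (`withDensity` of Lebesgue restricted to the open unit ball), `discHyperbolicMeasure_apply`, and THE THEOREM
  **`discHyperbolicMeasure_image_discMoebius`**: `μ_hyp (M_h '' s) = μ_hyp s` for every measurable `s ⊆ 𝔻` (Mathlib's Jacobian change of variables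
  `lintegral_image_eq_lintegral_abs_det_fderiv_mul` + `|M_h′|² · (1 − |M_h w|²)⁻² = (1 − |w|²)⁻²`); `discHyperbolicMeasure_eq_inter` (`μ_hyp` is carried by `𝔻`) and the
  `Measure.map` form **`map_discMoebius_discHyperbolicMeasure`** (`(M_h)_* μ_hyp = μ_hyp`, given an inverse `h′ ∈ U(1,1)`).
NOT HERE: the
disc as a homogeneous space, the polar∕`(s,θ)` form of `μ_hyp`.  HONEST LABEL: HC_CM is proved only modulo the printed citations until rung 0 closes; this is textbook
hyperbolic geometry and pays nothing by itself.

## References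
* [Helgason2000] S. Helgason, *Groups and Geometric Analysis*, Math. Surveys Monogr. 83 (AMS 2000), Introduction §4 (the Poincaré disc, `SU(1,1)`, the invariant measure `(1 − |z|²)⁻² dz`).
* [Rudin1980] W. Rudin, *Function Theory in the Unit Ball of ℂⁿ* (1980), Thm. 2.2.6 (`J_ℝψ = |det ψ′|²` and the invariant measure `(1 − |z|²)^{−(n+1)} dν`, here `n = 1`).
-/

set_option autoImplicit false

noncomputable section

open _root_.Complex MeasureTheory Measure Set Filter
open scoped Topology ENNReal NNReal ComplexConjugate Matrix

namespace Literature.Analysis.Complex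

/-! ## §1 The algebra of `U(1,1)` and the Möbius map on the disc -/

/-- **The Möbius map of `h ∈ M₂(ℂ)` in the disc convention**: `M_h w = (h₁₀ + h₁₁ w) ∕ (h₀₀ + h₀₁ w)` — the image of the line through `(1, w)` under `h`, read in the
chart `v ↦ v₁ ∕ v₀` (so the orbit map `h ↦ h₁₀ ∕ h₀₀ = M_h 0` is equivariant).  Junk value `(·) ∕ 0 = 0` off the domain of definition. [cite: Helgason2000, Introduction §4] -/
def discMoebius (h : Matrix (Fin 2) (Fin 2) ℂ) (w : ℂ) : ℂ := (h 1 0 + h 1 1 * w) / (h 0 0 + h 0 1 * w)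

/-- Unfolding of `discMoebius`. [cite: Helgason2000, Introduction §4] -/
theorem discMoebius_apply (h : Matrix (Fin 2) (Fin 2) ℂ) (w : ℂ) : discMoebius h w = (h 1 0 + h 1 1 * w) / (h 0 0 + h 0 1 * w) := rfl

section Algebra

variable {h : Matrix (Fin 2) (Fin 2) ℂ} (hU : hᴴ * Matrix.diagonal ![(1 : ℂ), -1] * h = Matrix.diagonal ![(1 : ℂ), -1])
include hU

/-- `h̄₀₀h₀₀ − h̄₁₀h₁₀ = 1` (entry `(0,0)` of `hᴴJh = J`). [cite: Helgason2000, Introduction §4] -/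
theorem conj_apply_mul_apply_00 : conj (h 0 0) * h 0 0 - conj (h 1 0) * h 1 0 = 1 := by
  have e := congrFun (congrFun hU 0) 0
  simp [Matrix.mul_apply, Fin.sum_univ_two, Matrix.conjTranspose_apply, Matrix.diagonal] at e
  linear_combination e

/-- `h̄₀₁h₀₁ − h̄₁₁h₁₁ = −1` (entry `(1,1)`). [cite: Helgason2000, Introduction §4] -/
theorem conj_apply_mul_apply_11 : conj (h 0 1) * h 0 1 - conj (h 1 1) * h 1 1 = -1 := by
  have e := congrFun (congrFun hU 1) 1
  simp [Matrix.mul_apply, Fin.sum_univ_two, Matrix.conjTranspose_apply, Matrix.diagonal] at e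
  linear_combination e

/-- `h̄₀₀h₀₁ − h̄₁₀h₁₁ = 0` (entry `(0,1)`). [cite: Helgason2000, Introduction §4] -/
theorem conj_apply_mul_apply_01 : conj (h 0 0) * h 0 1 - conj (h 1 0) * h 1 1 = 0 := by
  have e := congrFun (congrFun hU 0) 1
  simp [Matrix.mul_apply, Fin.sum_univ_two, Matrix.conjTranspose_apply, Matrix.diagonal] at e
  linear_combination e

/-- `h̄₀₁h₀₀ − h̄₁₁h₁₀ = 0` (entry `(1,0)`). [cite: Helgason2000, Introduction §4] -/
theorem conj_apply_mul_apply_10 : conj (h 0 1) * h 0 0 - conj (h 1 1) * h 1 0 = 0 := by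
  have e := congrFun (congrFun hU 1) 0
  simp [Matrix.mul_apply, Fin.sum_univ_two, Matrix.conjTranspose_apply, Matrix.diagonal] at e
  linear_combination e

/-- **THE KEY IDENTITY** `⟨h·(1,w), h·(1,w)⟩_J = ⟨(1,w),(1,w)⟩_J`, i.e. `den̄·den − num̄·num = 1 − w̄w` for `den = h₀₀ + h₀₁w`, `num = h₁₀ + h₁₁w`.
[cite: Helgason2000, Introduction §4] -/
theorem conj_den_mul_den_sub_conj_num_mul_num (w : ℂ) :
    conj (h 0 0 + h 0 1 * w) * (h 0 0 + h 0 1 * w) - conj (h 1 0 + h 1 1 * w) * (h 1 0 + h 1 1 * w) = 1 - conj w * w := by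
  have e00 := conj_apply_mul_apply_00 hU
  have e11 := conj_apply_mul_apply_11 hU
  have e01 := conj_apply_mul_apply_01 hU
  have e10 := conj_apply_mul_apply_10 hU
  simp only [map_add, map_mul]
  linear_combination e00 + w * e01 + conj w * e10 + (conj w * w) * e11

/-- Real form: `|den|² − |num|² = 1 − |w|²`. [cite: Helgason2000, Introduction §4] -/
theorem normSq_den_sub_normSq_num (w : ℂ) :
    Complex.normSq (h 0 0 + h 0 1 * w) - Complex.normSq (h 1 0 + h 1 1 * w) = 1 - Complex.normSq w := by
  have e := conj_den_mul_den_sub_conj_num_mul_num hU w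
  rw [← Complex.normSq_eq_conj_mul_self, ← Complex.normSq_eq_conj_mul_self, ← Complex.normSq_eq_conj_mul_self] at e
  exact_mod_cast e

/-- The denominator does not vanish on the disc: `|h₀₀ + h₀₁w|² = 1 − |w|² + |h₁₀ + h₁₁w|² > 0`. [cite: Helgason2000, Introduction §4] -/
theorem den_ne_zero_of_norm_lt_one {w : ℂ} (hw : ‖w‖ < 1) : h 0 0 + h 0 1 * w ≠ 0 := by
  intro h0
  have e := normSq_den_sub_normSq_num hU w
  rw [h0, map_zero, Complex.normSq_eq_norm_sq w] at e
  have h1 : ‖w‖ ^ 2 < 1 := by nlinarith [norm_nonneg w]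
  nlinarith [Complex.normSq_nonneg (h 1 0 + h 1 1 * w)]

/-- `|det h| = 1` for `h ∈ U(1,1)` (`det(hᴴJh) = det J`). [cite: Helgason2000, Introduction §4] -/
theorem norm_det_eq_one : ‖h.det‖ = 1 := by
  have e := congrArg Matrix.det hU
  rw [Matrix.det_mul, Matrix.det_mul, Matrix.det_conjTranspose, Matrix.det_diagonal] at e
  simp [Fin.prod_univ_two] at e
  -- `e : star (det h) * det h = 1` up to normal form
  have e' : Complex.normSq h.det = 1 := by
    have := e
    rw [← Complex.normSq_eq_conj_mul_self] at this
    exact_mod_cast this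
  rw [Complex.normSq_eq_norm_sq] at e'
  nlinarith [norm_nonneg h.det]

/-- `det h ≠ 0`. [cite: Helgason2000, Introduction §4] -/
theorem det_ne_zero : h.det ≠ 0 := fun h0 => by
  have e := norm_det_eq_one hU
  rw [h0, norm_zero] at e
  exact zero_ne_one e

/-- **`M_h` MAPS THE DISC TO THE DISC**: `1 − |M_h w|² = (1 − |w|²) ∕ |h₀₀ + h₀₁w|²`. [cite: Helgason2000, Introduction §4] -/
theorem one_sub_norm_sq_discMoebius {w : ℂ} (hw : ‖w‖ < 1) :
    1 - ‖discMoebius h w‖ ^ 2 = (1 - ‖w‖ ^ 2) / ‖h 0 0 + h 0 1 * w‖ ^ 2 := by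
  have hden := den_ne_zero_of_norm_lt_one hU hw
  have hden' : 0 < ‖h 0 0 + h 0 1 * w‖ ^ 2 := by positivity
  have e := normSq_den_sub_normSq_num hU w
  rw [Complex.normSq_eq_norm_sq, Complex.normSq_eq_norm_sq, Complex.normSq_eq_norm_sq] at e
  rw [discMoebius_apply, norm_div, div_pow, eq_div_iff hden'.ne', sub_mul, div_mul_cancel₀ _ hden'.ne', one_mul]
  linarith

/-- `|M_h w| < 1` for `|w| < 1`. [cite: Helgason2000, Introduction §4] -/
theorem norm_discMoebius_lt_one {w : ℂ} (hw : ‖w‖ < 1) : ‖discMoebius h w‖ < 1 := by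
  have hden := den_ne_zero_of_norm_lt_one hU hw
  have hpos : 0 < 1 - ‖discMoebius h w‖ ^ 2 := by
    rw [one_sub_norm_sq_discMoebius hU hw]
    have h1 : ‖w‖ ^ 2 < 1 := by nlinarith [norm_nonneg w]
    positivity
  nlinarith [norm_nonneg (discMoebius h w)]

/-- `M_h` maps the open unit disc into itself. [cite: Helgason2000, Introduction §4] -/
theorem mapsTo_discMoebius_ball : MapsTo (discMoebius h) (Metric.ball (0 : ℂ) 1) (Metric.ball (0 : ℂ) 1) := fun w hw => by
  rw [Metric.mem_ball, dist_zero_right] at hw ⊢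
  exact norm_discMoebius_lt_one hU hw

/-- **`M_h` IS INJECTIVE ON THE DISC** (`num(w₁)·den(w₂) − num(w₂)·den(w₁) = det h · (w₁ − w₂)`, `det h ≠ 0`). [cite: Helgason2000, Introduction §4] -/
theorem injOn_discMoebius_ball : InjOn (discMoebius h) (Metric.ball (0 : ℂ) 1) := by
  intro w₁ hw₁ w₂ hw₂ heq
  rw [Metric.mem_ball, dist_zero_right] at hw₁ hw₂
  have h₁ := den_ne_zero_of_norm_lt_one hU hw₁
  have h₂ := den_ne_zero_of_norm_lt_one hU hw₂
  rw [discMoebius_apply, discMoebius_apply, div_eq_div_iff h₁ h₂] at heq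
  have hdet : h.det * (w₁ - w₂) = 0 := by
    rw [Matrix.det_fin_two]
    linear_combination heq
  rcases mul_eq_zero.mp hdet with h0 | h0
  · exact absurd h0 (det_ne_zero hU)
  · exact sub_eq_zero.mp h0

end Algebra

/-- `M_1 = id`. [cite: Helgason2000, Introduction §4] -/
theorem discMoebius_one (w : ℂ) : discMoebius 1 w = w := by
  simp [discMoebius_apply]

/-- **THE COMPOSITION LAW** `M_{gh} w = M_g (M_h w)` wherever `M_h` is defined at `w` (no condition on `g`: if the `g`-denominator vanishes both sides are the junk value `0`).
[cite: Helgason2000, Introduction §4] -/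
theorem discMoebius_mul (g h : Matrix (Fin 2) (Fin 2) ℂ) {w : ℂ} (hden : h 0 0 + h 0 1 * w ≠ 0) :
    discMoebius (g * h) w = discMoebius g (discMoebius h w) := by
  have e1 : g 1 0 + g 1 1 * discMoebius h w = (g 1 0 * (h 0 0 + h 0 1 * w) + g 1 1 * (h 1 0 + h 1 1 * w)) / (h 0 0 + h 0 1 * w) := by
    rw [discMoebius_apply, ← mul_div_assoc, ← add_div' _ _ _ hden]
  have e2 : g 0 0 + g 0 1 * discMoebius h w = (g 0 0 * (h 0 0 + h 0 1 * w) + g 0 1 * (h 1 0 + h 1 1 * w)) / (h 0 0 + h 0 1 * w) := by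
    rw [discMoebius_apply, ← mul_div_assoc, ← add_div' _ _ _ hden]
  rw [discMoebius_apply g, e1, e2, div_div_div_cancel_right₀ hden, discMoebius_apply]
  simp only [Matrix.mul_apply, Fin.sum_univ_two]
  congr 1 <;> ring

/-- `M_h` is measurable (a rational function; junk `0` at the pole). [cite: Helgason2000, Introduction §4] -/
theorem measurable_discMoebius (h : Matrix (Fin 2) (Fin 2) ℂ) : Measurable (discMoebius h) :=
  (measurable_const.add (measurable_const.mul measurable_id)).div (measurable_const.add (measurable_const.mul measurable_id))

/-! ## §2 Calculus: the complex derivative of `M_h` and its real Jacobian -/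

/-- **`M_h′(w) = det h ∕ (h₀₀ + h₀₁w)²`** wherever the denominator is non-zero (quotient rule). [cite: Helgason2000, Introduction §4] -/
theorem hasDerivAt_discMoebius (h : Matrix (Fin 2) (Fin 2) ℂ) {w : ℂ} (hden : h 0 0 + h 0 1 * w ≠ 0) :
    HasDerivAt (discMoebius h) (h.det / (h 0 0 + h 0 1 * w) ^ 2) w := by
  have hnum : HasDerivAt (fun w : ℂ => h 1 0 + h 1 1 * w) (h 1 1) w := by
    have e := ((hasDerivAt_id' w).const_mul (h 1 1)).const_add (h 1 0)
    rwa [mul_one] at e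
  have hden' : HasDerivAt (fun w : ℂ => h 0 0 + h 0 1 * w) (h 0 1) w := by
    have e := ((hasDerivAt_id' w).const_mul (h 0 1)).const_add (h 0 0)
    rwa [mul_one] at e
  have hq : HasDerivAt (discMoebius h) ((h 1 1 * (h 0 0 + h 0 1 * w) - (h 1 0 + h 1 1 * w) * h 0 1) / (h 0 0 + h 0 1 * w) ^ 2) w :=
    hnum.div hden' hden
  refine hq.congr_deriv ?_
  rw [Matrix.det_fin_two]
  ring

/-! ## §3 The hyperbolic measure of the disc and its invariance -/

/-- **The hyperbolic measure of the unit disc** `μ_hyp = (1 − ‖w‖²)⁻² · dA|_𝔻`: Lebesgue measure of `ℂ` restricted to the open unit ball, with the density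
`(1 − ‖w‖²)⁻²` (a measure on `ℂ` carried by the disc). [cite: Helgason2000, Introduction §4] -/
def discHyperbolicMeasure : Measure ℂ :=
  (volume.restrict (Metric.ball (0 : ℂ) 1)).withDensity fun w => ENNReal.ofReal (((1 - ‖w‖ ^ 2)⁻¹) ^ 2)

/-- `μ_hyp(s) = ∫⁻_s (1 − ‖w‖²)⁻² dA` for `s ⊆ 𝔻`. [cite: Helgason2000, Introduction §4] -/
theorem discHyperbolicMeasure_apply {s : Set ℂ} (hsub : s ⊆ Metric.ball (0 : ℂ) 1) :
    discHyperbolicMeasure s = ∫⁻ w in s, ENNReal.ofReal (((1 - ‖w‖ ^ 2)⁻¹) ^ 2) := by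
  rw [discHyperbolicMeasure, withDensity_apply', Measure.restrict_restrict_of_subset hsub]

/-- **INVARIANCE OF THE HYPERBOLIC MEASURE UNDER `U(1,1)`**: for `hᴴ·diag(1,−1)·h = diag(1,−1)` and every measurable `s ⊆ 𝔻`, `μ_hyp (M_h '' s) = μ_hyp s` —
Mathlib's Jacobian change of variables (`lintegral_image_eq_lintegral_abs_det_fderiv_mul`) with `|det_ℝ DM_h(w)| = |M_h′(w)|² = ‖h₀₀ + h₀₁w‖⁻⁴` and
`(1 − |M_h w|²)⁻² = ‖h₀₀ + h₀₁w‖⁴ (1 − |w|²)⁻²`.  The disc twin of Mathlib's `UpperHalfPlane` `SMulInvariantMeasure (GL (Fin 2) ℝ) ℍ volume`.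
[cite: Helgason2000, Introduction §4] [cite: Rudin1980, Thm. 2.2.6] -/
theorem discHyperbolicMeasure_image_discMoebius {h : Matrix (Fin 2) (Fin 2) ℂ}
    (hU : hᴴ * Matrix.diagonal ![(1 : ℂ), -1] * h = Matrix.diagonal ![(1 : ℂ), -1]) {s : Set ℂ} (hs : MeasurableSet s)
    (hsub : s ⊆ Metric.ball (0 : ℂ) 1) :
    discHyperbolicMeasure (discMoebius h '' s) = discHyperbolicMeasure s := by
  have himg : discMoebius h '' s ⊆ Metric.ball (0 : ℂ) 1 := (Set.image_mono hsub).trans (mapsTo_discMoebius_ball hU).image_subset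
  rw [discHyperbolicMeasure_apply himg, discHyperbolicMeasure_apply hsub]
  have hderiv : ∀ w ∈ s, HasFDerivWithinAt (discMoebius h)
      ((ContinuousLinearMap.smulRight (1 : ℂ →L[ℂ] ℂ) (h.det / (h 0 0 + h 0 1 * w) ^ 2)).restrictScalars ℝ) s w := fun w hw => by
    have hw' : ‖w‖ < 1 := by simpa using hsub hw
    exact ((hasDerivAt_discMoebius h (den_ne_zero_of_norm_lt_one hU hw')).hasFDerivAt.restrictScalars ℝ).hasFDerivWithinAt
  rw [lintegral_image_eq_lintegral_abs_det_fderiv_mul volume hs hderiv ((injOn_discMoebius_ball hU).mono hsub)]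
  refine setLIntegral_congr_fun hs fun w hw => ?_
  have hw' : ‖w‖ < 1 := by simpa using hsub hw
  have hden := den_ne_zero_of_norm_lt_one hU hw'
  have hdenpos : 0 < ‖h 0 0 + h 0 1 * w‖ := norm_pos_iff.mpr hden
  have h1 : 0 < 1 - ‖w‖ ^ 2 := by nlinarith [norm_nonneg w]
  rw [LengthArea.det_restrictScalars_smulRight, one_sub_norm_sq_discMoebius hU hw', norm_div, norm_pow, norm_det_eq_one hU,
    ← ENNReal.ofReal_mul (abs_nonneg _)]
  congr 1
  rw [abs_of_nonneg (by positivity)]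
  field_simp

/-- `μ_hyp` is carried by the disc: `μ_hyp(A) = μ_hyp(A ∩ 𝔻)`. [cite: Helgason2000, Introduction §4] -/
theorem discHyperbolicMeasure_eq_inter (A : Set ℂ) : discHyperbolicMeasure A = discHyperbolicMeasure (A ∩ Metric.ball (0 : ℂ) 1) := by
  rw [discHyperbolicMeasure_apply Set.inter_subset_right, discHyperbolicMeasure, withDensity_apply',
    Measure.restrict_restrict' measurableSet_ball]

/-- **INVARIANCE, `Measure.map` FORM**: `(M_h)_* μ_hyp = μ_hyp` for `h ∈ U(1,1)` with an inverse `h′ ∈ U(1,1)` (`h′h = 1`; both hypotheses are free for elements of the GROUP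
`U(1,1)`, which is how the consumer (H2) uses it).  Proof: `M_h⁻¹(s) ∩ 𝔻 = M_{h′}(s ∩ 𝔻)` by the composition law, then the image form for `h′`.
[cite: Helgason2000, Introduction §4] [cite: Rudin1980, Thm. 2.2.6] -/
theorem map_discMoebius_discHyperbolicMeasure {h h' : Matrix (Fin 2) (Fin 2) ℂ}
    (hU : hᴴ * Matrix.diagonal ![(1 : ℂ), -1] * h = Matrix.diagonal ![(1 : ℂ), -1])
    (hU' : h'ᴴ * Matrix.diagonal ![(1 : ℂ), -1] * h' = Matrix.diagonal ![(1 : ℂ), -1]) (hinv : h' * h = 1) :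
    discHyperbolicMeasure.map (discMoebius h) = discHyperbolicMeasure := by
  have hinv' : h * h' = 1 := mul_eq_one_comm.mp hinv
  ext s hs
  rw [Measure.map_apply (measurable_discMoebius h) hs, discHyperbolicMeasure_eq_inter, discHyperbolicMeasure_eq_inter s]
  have hset : discMoebius h ⁻¹' s ∩ Metric.ball (0 : ℂ) 1 = discMoebius h' '' (s ∩ Metric.ball (0 : ℂ) 1) := by
    ext x
    simp only [Set.mem_inter_iff, Set.mem_preimage, Set.mem_image, Metric.mem_ball, dist_zero_right]
    constructor
    · rintro ⟨hx, hxb⟩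
      refine ⟨discMoebius h x, ⟨hx, norm_discMoebius_lt_one hU hxb⟩, ?_⟩
      rw [← discMoebius_mul h' h (den_ne_zero_of_norm_lt_one hU hxb), hinv, discMoebius_one]
    · rintro ⟨y, ⟨hy, hyb⟩, rfl⟩
      refine ⟨?_, norm_discMoebius_lt_one hU' hyb⟩
      rw [← discMoebius_mul h h' (den_ne_zero_of_norm_lt_one hU' hyb), hinv', discMoebius_one]
      exact hy
  rw [hset, discHyperbolicMeasure_image_discMoebius hU' (hs.inter measurableSet_ball) Set.inter_subset_right]

end Literature.Analysis.Complex

end
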